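import Literature.NumberTheory.Sieve.PolymathGEHCutoffMarginals
import Mathlib.GroupTheory.Perm.Sign
import HarnessLib

/-!
# Polymath 8b, Theorem 3.15 — PROVED

Trunk AntSieve.  D. H. J. Polymath, *Variants of the Selberg sieve, and bounded intervals containing
many primes*, Res. Math. Sci. 1:12 (2014) = arXiv:1407.4897, **Theorem 3.15** (p. 11), verbatim:

> Set `ε := 1/4`. Then there exists a piecewise polynomial function `F : [0,+∞)³ → ℝ` supported on
> the simplex `(3/2)·R₃` and symmetric in the `t₁, t₂, t₃` variables, such that `F` is not
> identically zero and obeys the vanishing marginal condition `∫₀^∞ F(t₁,t₂,t₃) dt₃ = 0` whenever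
> `t₁, t₂ ≥ 0` with `t₁ + t₂ > 1 + ε`, and such that
> `3 ∫_{t₁+t₂ ≤ 1-ε} (∫₀^∞ F dt₃)² dt₁ dt₂ / ∫ F² > 2`.

This is the numerical input which, with Theorem 3.14 (`GEH[ϑ]`, `ε < 1/(k-1)`, a test function on
`(k/(k-1))·R_k` with vanishing marginals and `Σᵢ J_{i,1-ε}(F)/I(F) > 2m/ϑ` give `DHL[k, m+1]`),
yields Theorem 3.2(xii) `GEH ⟹ DHL[3,2]` — the named fact
`Literature.NumberTheory.Sieve.weakDHL_three_two_of_GEH` of `PolymathGEH.lean` (take `k = 3`,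
`m = 1`, `ϑ` close enough to `1`).

The witness is the explicit cutoff of §7.4 (`GEHCutoff.F3`, files `PolymathGEHCutoffDef/Basic/I/
Fibres/J/Marginals.lean`), and everything is proved exactly: `I(F) = 62082439864241/507343011840`
(`polymathI_F3`), `Σᵢ J_{i,3/4}(F) ≥ 9933190664926733/40587440947200 = J(F)` (`sum_polymathJ_ge`),
hence the ratio `> 2` by the printed margin `286648173/4966595189139280`; the marginal condition
holds off eleven lines of the `(t₁,t₂)`-plane (`marginal_ae_eq_zero`).

* `F3_perm` — symmetry under all of `S₃`;
* `exists_vanishingMarginalCutoff_three` — **Theorem 3.15** in the tree's language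
  (`polymathI`, `polymathJ`, `scaledSimplex` of `PolymathBoundedGaps.lean`; measurability,
  boundedness and the support replace "piecewise polynomial"; the marginal condition is stated for
  each of the three coordinates and almost everywhere, which is how Theorem 3.14 consumes it — the
  printed `F` is itself only specified almost everywhere, p. 32);
* `two_mul_polymathI_lt_three_mul_polymathJ` — the displayed ratio `3 J₃/I > 2` itself.

## References

* [Polymath8b2014] D. H. J. Polymath, Res. Math. Sci. 1 (2014), Art. 12 = arXiv:1407.4897,
  Theorem 3.15 (p. 11), Theorem 3.14, §7.4 (pp. 31–34).
-/

noncomputable section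

open MeasureTheory Finset

namespace Literature.NumberTheory.Sieve

namespace GEHCutoff

/-- A transposition of two coordinates leaves `F3` invariant. [cite: Polymath8b2014, Theorem 3.15] -/
theorem F3_comp_swap (x y : Fin 3) (hxy : x ≠ y) (s : Fin 3 → ℝ) :
    F3 (fun j => s (Equiv.swap x y j)) = F3 s := by
  fin_cases x <;> fin_cases y
  · exact absurd rfl hxy
  · show F3 (fun j => s (Equiv.swap (0 : Fin 3) 1 j)) = F3 s
    rw [rearr_102]; exact F3_swap01 s
  · show F3 (fun j => s (Equiv.swap (0 : Fin 3) 2 j)) = F3 s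
    rw [rearr_210]; exact F3_swap02 s
  · show F3 (fun j => s (Equiv.swap (1 : Fin 3) 0 j)) = F3 s
    rw [Equiv.swap_comm, rearr_102]; exact F3_swap01 s
  · exact absurd rfl hxy
  · show F3 (fun j => s (Equiv.swap (1 : Fin 3) 2 j)) = F3 s
    rw [rearr_021]; exact F3_swap12 s
  · show F3 (fun j => s (Equiv.swap (2 : Fin 3) 0 j)) = F3 s
    rw [Equiv.swap_comm, rearr_210]; exact F3_swap02 s
  · show F3 (fun j => s (Equiv.swap (2 : Fin 3) 1 j)) = F3 s
    rw [Equiv.swap_comm, rearr_021]; exact F3_swap12 s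
  · exact absurd rfl hxy

/-- **`F3` is symmetric** in its three variables: invariant under every permutation of the
coordinates ("symmetric in the `t₁, t₂, t₃` variables", Theorem 3.15). [cite: Polymath8b2014, Theorem 3.15] -/
theorem F3_perm (σ : Equiv.Perm (Fin 3)) : ∀ t : Fin 3 → ℝ, F3 (fun k => t (σ k)) = F3 t := by
  refine Equiv.Perm.swap_induction_on σ (fun t => ?_) (fun f x y hxy ih t => ?_)
  · have e : (fun k => t ((1 : Equiv.Perm (Fin 3)) k)) = t := funext fun k => by
      simp only [Equiv.Perm.one_apply]
    rw [e]
  · have e : (fun k => t ((Equiv.swap x y * f) k)) = fun k => (fun j => t (Equiv.swap x y j)) (f k) :=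
      funext fun k => by simp only [Equiv.Perm.mul_apply]
    rw [e]
    exact (ih fun j => t (Equiv.swap x y j)).trans (F3_comp_swap x y hxy t)

/-- **The displayed ratio of Theorem 3.15**: `3 J_{3,1-ε}(F) > 2 I(F)` for `F = F3`, `ε = 1/4`
("`3 ∫_{t₁+t₂≤1-ε} (∫ F dt₃)² / ∫ F² > 2`", p. 11; p. 34: the ratio is
`2 + 286648173/4966595189139280`). [cite: Polymath8b2014, Theorem 3.15] -/
theorem two_mul_polymathI_lt_three_mul_polymathJ :
    2 * polymathI 3 F3 < 3 * polymathJ 3 (1 - 1 / 4) 2 F3 := by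
  rw [show (1 - 1 / 4 : ℝ) = 3 / 4 by norm_num, polymathI_F3]
  have := polymathJ_two_ge
  have gap : 2 * (62082439864241 / 507343011840 : ℝ) < 3 * (2 * (9933190664926733 / 243524645683200)) := by
    norm_num
  linarith

/-- **Polymath 8b, Theorem 3.15 (a piecewise polynomial cutoff), PROVED.**  With `ε = 1/4` there is
`F : [0,∞)³ → ℝ` — measurable, bounded, supported on the simplex `(3/2)·R₃`, symmetric in its three
variables, not (almost everywhere) zero (`I(F) > 0`) — obeying the vanishing marginal condition
`∫₀^∞ F dt_i = 0` for (each `i` and) almost every `(t_j)_{j ≠ i} ≥ 0` with `Σ_{j≠i} t_j > 1 + ε`,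
and `Σᵢ J_{i,1-ε}(F) > 2 I(F)` (equivalently, by symmetry, `3 J_{3,1-ε}(F)/I(F) > 2`:
`two_mul_polymathI_lt_three_mul_polymathJ`).  The witness is the printed cutoff of §7.4
(`GEHCutoff.F3`); "piecewise polynomial" is rendered by measurability, boundedness and the support,
which is all Theorem 3.14 uses.  `I`, `J_{i,r}` and `r·R_k` are the tree's `polymathI`, `polymathJ`,
`scaledSimplex` (`PolymathBoundedGaps.lean`). [cite: Polymath8b2014, Theorem 3.15] -/
theorem exists_vanishingMarginalCutoff_three :
    ∃ F : (Fin 3 → ℝ) → ℝ,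
      Measurable F ∧ (∃ C : ℝ, ∀ t, |F t| ≤ C) ∧ Function.support F ⊆ scaledSimplex 3 (3 / 2) ∧
      (∀ σ : Equiv.Perm (Fin 3), ∀ t, F (fun k => t (σ k)) = F t) ∧
      (∀ i : Fin 3, ∀ᵐ t' : Fin 2 → ℝ, (∀ j, 0 ≤ t' j) → (1 + 1 / 4 : ℝ) < ∑ j, t' j →
        ∫ u in Set.Ioi 0, F (Fin.insertNth i u t') = 0) ∧
      0 < polymathI 3 F ∧ 2 * polymathI 3 F < ∑ i : Fin 3, polymathJ 3 (1 - 1 / 4) i F :=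
  ⟨F3, measurable_F3, exists_bound_F3, support_F3_subset, F3_perm, marginal_ae_eq_zero,
    polymathI_F3_pos, two_mul_polymathI_lt_sum_polymathJ⟩

end GEHCutoff

end Literature.NumberTheory.Sieve
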